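import Mathlib.Analysis.SpecialFunctions.ExpDeriv
import Mathlib.Analysis.Calculus.ContDiff.Operations
import Mathlib.Analysis.Calculus.FDeriv.CompCLM
import Mathlib.Algebra.BigOperators.Fin
import HarnessLib

/-!
# Jets of the exponential of a linear form: `Dⁿ(exp ∘ L)(x)(m) = exp(L x) · Π_i L(m_i)`

Topic `Analysis/Calculus`; namespace `Literature.Analysis.Calculus`.  THEOREMS ONLY (no `def`, no instance, no notation, no axiom, no named fact, no `sorry`).
For a continuous `ℝ`-linear `L : E → ℂ`, the `n`-th Fréchet derivative of `y ↦ exp(L y)` on a word `m : Fin n → E` is `exp(L x) · Π_i L(m i)`; hence a constant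
multiple `K · exp(L y)` has jets `K · exp(L x) · Π_i L(m i)`, vanishing as soon as ONE letter lies in `ker L`; real-phase form `y ↦ exp(i Λ(y))`, `Λ : E → ℝ` linear.
Written for the (I₃-TRANSF) all-orders step (W2) «jets of the entire unit `V_S = w_S·exp(iΛ_S)`» of the `pub/hodgecm-mathlib` line LH3 (crux H413,
`stmt-HodgeConjecture-24833`; LH7-p02 (g2)'s by-name ask 2026-09-02T07:58:17Z), seat F0P3a-p09 (g5).  Proof: induction on `n` through
`D^{n+1}f(x)(m) = ∂_{m₀}[y ↦ Dⁿf(y)(tail m)](x)` (`iteratedFDeriv_succ_apply_left`) and `HasFDerivAt.cexp`.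

## References
* [HormanderALPDO1] L. Hörmander, *The Analysis of Linear Partial Differential Operators I*, Springer (1983), §1.1 p. 12; §7.1 p. 160 (derivatives of `e^{i⟨x,ξ⟩}`).
* [Bouaziz1994IntegralesOrbitales] A. Bouaziz, *Intégrales orbitales sur les algèbres de Lie réductives*, Invent. Math. 115 (1994), §3.2 (I₃) p. 580 (the twist `r_Ψ`).
-/

open Set Filter Topology Finset Function Complex
open scoped ContDiff

namespace Literature.Analysis.Calculus

variable {E : Type*} [NormedAddCommGroup E] [NormedSpace ℝ E]

/-- `y ↦ exp(L y)` is smooth. [cite: HormanderALPDO1, §1.1 p. 12] -/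
theorem contDiff_cexp_comp_clm (L : E →L[ℝ] ℂ) : ContDiff ℝ ∞ fun y => Complex.exp (L y) :=
  Complex.contDiff_exp.comp L.contDiff

/-- **JETS OF THE EXPONENTIAL OF A LINEAR FORM**: `Dⁿ(y ↦ exp(L y))(x)(m) = exp(L x) · Π_i L(m i)`. [cite: HormanderALPDO1, §7.1 p. 160] -/
theorem iteratedFDeriv_cexp_comp_clm_apply (L : E →L[ℝ] ℂ) (x : E) (n : ℕ) (m : Fin n → E) :
    iteratedFDeriv ℝ n (fun y => Complex.exp (L y)) x m = Complex.exp (L x) * ∏ i, L (m i) := by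
  induction n generalizing x with
  | zero => rw [iteratedFDeriv_zero_apply, Fintype.prod_empty, mul_one]
  | succ n ih =>
    rw [iteratedFDeriv_succ_apply_left]
    have hD : DifferentiableAt ℝ (iteratedFDeriv ℝ n fun y => Complex.exp (L y)) x :=
      (contDiff_cexp_comp_clm L).differentiable_iteratedFDeriv (by exact_mod_cast ENat.coe_lt_top n) x
    rw [← fderiv_continuousMultilinear_apply_const_apply hD (Fin.tail m) (m 0)]
    have hfun : (fun y => iteratedFDeriv ℝ n (fun y => Complex.exp (L y)) y (Fin.tail m)) =
        fun y => Complex.exp (L y) * ∏ i, L (Fin.tail m i) := funext fun y => ih y (Fin.tail m)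
    rw [hfun]
    have hderiv : HasFDerivAt (fun y => Complex.exp (L y) * ∏ i, L (Fin.tail m i))
        ((∏ i, L (Fin.tail m i)) • (Complex.exp (L x) • L)) x := by
      have h1 : HasFDerivAt (fun y => Complex.exp (L y)) (Complex.exp (L x) • L) x := L.hasFDerivAt.cexp
      exact h1.mul_const _
    rw [hderiv.fderiv, Fin.prod_univ_succ]
    show (∏ i, L (Fin.tail m i)) • (Complex.exp (L x) • L (m 0)) = _
    simp only [Fin.tail, smul_eq_mul]
    ring

/-- **JETS OF A CONSTANT MULTIPLE**: `Dⁿ(y ↦ K·exp(L y))(x)(m) = K · exp(L x) · Π_i L(m i)`. [cite: HormanderALPDO1, §7.1 p. 160] -/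
theorem iteratedFDeriv_const_mul_cexp_comp_clm_apply (K : ℂ) (L : E →L[ℝ] ℂ) (x : E) (n : ℕ) (m : Fin n → E) :
    iteratedFDeriv ℝ n (fun y => K * Complex.exp (L y)) x m = K * Complex.exp (L x) * ∏ i, L (m i) := by
  have h : (fun y => K * Complex.exp (L y)) = fun y => K • Complex.exp (L y) := rfl
  rw [h, iteratedFDeriv_const_smul_apply' ((contDiff_cexp_comp_clm L).contDiffAt.of_le (by exact_mod_cast le_top))]
  show K • iteratedFDeriv ℝ n (fun y => Complex.exp (L y)) x m = _
  rw [iteratedFDeriv_cexp_comp_clm_apply, smul_eq_mul, mul_assoc]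

/-- **A LETTER IN THE KERNEL KILLS THE JET**: if `L (m i) = 0` for some letter then `Dⁿ(y ↦ K·exp(L y))(x)(m) = 0`. [cite: HormanderALPDO1, §7.1 p. 160] -/
theorem iteratedFDeriv_const_mul_cexp_comp_clm_apply_eq_zero (K : ℂ) (L : E →L[ℝ] ℂ) (x : E) {n : ℕ} {m : Fin n → E} {i : Fin n}
    (hi : L (m i) = 0) : iteratedFDeriv ℝ n (fun y => K * Complex.exp (L y)) x m = 0 := by
  rw [iteratedFDeriv_const_mul_cexp_comp_clm_apply, Finset.prod_eq_zero (Finset.mem_univ i) hi, mul_zero]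

/-- **REAL-PHASE FORM**: for a real linear form `Λ`, `Dⁿ(y ↦ exp(i Λ y))(x)(m) = exp(i Λ x) · Π_i (i Λ(m i))`. [cite: HormanderALPDO1, §7.1 p. 160] -/
theorem iteratedFDeriv_cexp_ofReal_mul_I_apply (Λ : E →L[ℝ] ℝ) (x : E) (n : ℕ) (m : Fin n → E) :
    iteratedFDeriv ℝ n (fun y => Complex.exp ((Λ y : ℂ) * I)) x m = Complex.exp ((Λ x : ℂ) * I) * ∏ i, ((Λ (m i) : ℂ) * I) := by
  have hL : ∀ y, (I • (Complex.ofRealCLM.comp Λ)) y = (Λ y : ℂ) * I := fun y => by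
    show I • ((Complex.ofRealCLM.comp Λ) y) = _
    rw [ContinuousLinearMap.comp_apply, Complex.ofRealCLM_apply, smul_eq_mul, mul_comm]
  have h : (fun y => Complex.exp ((Λ y : ℂ) * I)) = fun y => Complex.exp ((I • (Complex.ofRealCLM.comp Λ)) y) := funext fun y => by rw [hL]
  rw [h, iteratedFDeriv_cexp_comp_clm_apply]
  simp only [hL]

/-- **REAL-PHASE FORM WITH A CONSTANT**: `Dⁿ(y ↦ K·exp(i Λ y))(x)(m) = K · exp(i Λ x) · Π_i (i Λ(m i))`; it vanishes when some letter lies in `ker Λ`.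
[cite: HormanderALPDO1, §7.1 p. 160] [cite: Bouaziz1994IntegralesOrbitales, §3.2 (I₃) p. 580] -/
theorem iteratedFDeriv_const_mul_cexp_ofReal_mul_I_apply (K : ℂ) (Λ : E →L[ℝ] ℝ) (x : E) (n : ℕ) (m : Fin n → E) :
    iteratedFDeriv ℝ n (fun y => K * Complex.exp ((Λ y : ℂ) * I)) x m = K * Complex.exp ((Λ x : ℂ) * I) * ∏ i, ((Λ (m i) : ℂ) * I) := by
  have hL : ∀ y, (I • (Complex.ofRealCLM.comp Λ)) y = (Λ y : ℂ) * I := fun y => by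
    show I • ((Complex.ofRealCLM.comp Λ) y) = _
    rw [ContinuousLinearMap.comp_apply, Complex.ofRealCLM_apply, smul_eq_mul, mul_comm]
  have h : (fun y => K * Complex.exp ((Λ y : ℂ) * I)) = fun y => K * Complex.exp ((I • (Complex.ofRealCLM.comp Λ)) y) := funext fun y => by rw [hL]
  rw [h, iteratedFDeriv_const_mul_cexp_comp_clm_apply]
  simp only [hL]

/-- The real-phase jet vanishes when a letter is in `ker Λ`. [cite: HormanderALPDO1, §7.1 p. 160] -/
theorem iteratedFDeriv_const_mul_cexp_ofReal_mul_I_apply_eq_zero (K : ℂ) (Λ : E →L[ℝ] ℝ) (x : E) {n : ℕ} {m : Fin n → E} {i : Fin n}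
    (hi : Λ (m i) = 0) : iteratedFDeriv ℝ n (fun y => K * Complex.exp ((Λ y : ℂ) * I)) x m = 0 := by
  rw [iteratedFDeriv_const_mul_cexp_ofReal_mul_I_apply,
    Finset.prod_eq_zero (Finset.mem_univ i) (by rw [hi, Complex.ofReal_zero, zero_mul]), mul_zero]

end Literature.Analysis.Calculus
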